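import Mathlib
import HarnessLib
import Literature.Analysis.FluidPDE.SelfSimilar
import Summits.NavierStokesRegularity.NavierStokesRegularity.Theorems.QuarterLogPincerThinCascadeDefs
import Summits.NavierStokesRegularity.NavierStokesRegularity.Theorems.TypeIQuarterGateScarEnvelopeTypeINearOneRateDss

/-!
# Crux `QuarterLogPincer.TypeIQuantSubcubicExp` (stmt-NavierStokesRegularity-24077), line `thin_cascade`:
  PROVED SUB-CASES of the deciding stub S3 on the self-similar stratum, BY NAME

Lead-prover file (ns-tc-p1 g4; DIRECTOR-NS #210 (1)(a); `--supports stmt-NavierStokesRegularity-24077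
--as helper`).  S3 `stub_thinCascadeLiouville` («no thin singular Type-I ancient object», the DSS wall)
is OPEN; the tree now proves the following constraints on its object, recorded here under the crux's
own route so that census lines can cite landed names:

* `thinObject_not_dss_nearOne (M)` — for every Type-I constant `M` there is `c₁(M) > 1` such that NO
  thin object `ThinObject M q v g` (any budget `q`, any trace `g`) is `c`-discretely self-similar with
  `1 < c < c₁(M)`: the `x₀ = 0` case of the LINE 6 rung corollary
  `Cruxes.ScarEnvelopeTypeI.AxisActivity.thinObject_not_nearOneDss` (ns-idea-7, landed p629934 by
  ns-in-wu-con), itself from `nearOneRateDss_proof : NearOneRateDss` (near-one backward-DSS exclusion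
  in the KNSS time-rate class `IsTypeIAncientMild M`, every `M`);
* `thinObject_not_dss_nearOne_shift (M)` — the same about an arbitrary centre `x₀` (re-export by name);
* `thinObject_not_selfSimilar` — NO thin object is (continuously) backward self-similar
  (`IsSelfSimilar v`: `u_λ = u` for all `λ > 0`), since it would be `c`-DSS for `c` near `1`.

Together with `Theorems.ThinCascade.not_thinObject_of_lt_one` (`M < 1`, p626481) these are the proved
strata of S3; the open content is `M ≥ 1` and objects that are not self-similar or are `λ`-DSS only
for `λ ≥ c₁(M)` (Bradshaw–Tsai 2017 §5, open in print).

HONEST FRAMING: constraints on S3's enemy, not a proof of S3; the crux `TypeIQuantSubcubicExp`, its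
parent `SuperlogCubeRate`, item 23843 and Navier–Stokes regularity remain OPEN; no summit statement is
proved by this file.
-/

noncomputable section

-- the summit-side namespace `Summit.NavierStokesRegularity.NavierStokesRegularity.…` (single-conjunct summit,
-- D-0017) repeats a component by design; the dupNamespace linter would flag every declaration.
set_option linter.dupNamespace false

namespace Summit.NavierStokesRegularity.NavierStokesRegularity.Theorems.ThinCascade

open MeasureTheory Set Function Filter Topology Metric
open Literature.Analysis Literature.Analysis.FluidPDE
open Summit.NavierStokesRegularity.NavierStokesRegularity.Cruxes.TypeIQuantSubcubicExp.ThinCascade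
open Summit.NavierStokesRegularity.NavierStokesRegularity.Cruxes.ScarEnvelopeTypeI

/-- **No thin object is near-one DSS about any centre** (re-export by name of the LINE 6 rung
corollary `AxisActivity.thinObject_not_nearOneDss`): for every `M` there is `c₁(M) > 1` such that for
`1 < c < c₁(M)` no `ThinObject M q v g` has `x ↦ v(t, x + x₀)` `c`-discretely self-similar. [folklore] -/
theorem thinObject_not_dss_nearOne_shift (M : ℝ) :
    ∃ c₁ : ℝ, 1 < c₁ ∧ ∀ c : ℝ, 1 < c → c < c₁ →
      ∀ (q : ℝ) (v : ℝ → EuclideanSpace ℝ (Fin 3) → EuclideanSpace ℝ (Fin 3))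
        (g : EuclideanSpace ℝ (Fin 3) → EuclideanSpace ℝ (Fin 3)) (x₀ : EuclideanSpace ℝ (Fin 3)),
        ThinObject M q v g → ¬ IsDiscretelySelfSimilar c (fun t x => v t (x + x₀)) :=
  AxisActivity.thinObject_not_nearOneDss M

/-- **No thin object is near-one DSS (about the origin, its singular point).**  For every Type-I
constant `M` there is `c₁(M) > 1` such that no thin object `ThinObject M q v g` is `c`-discretely
self-similar for `1 < c < c₁(M)` — the `x₀ = 0` case of `AxisActivity.thinObject_not_nearOneDss`.
[folklore] -/
theorem thinObject_not_dss_nearOne (M : ℝ) :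
    ∃ c₁ : ℝ, 1 < c₁ ∧ ∀ c : ℝ, 1 < c → c < c₁ →
      ∀ (q : ℝ) (v : ℝ → EuclideanSpace ℝ (Fin 3) → EuclideanSpace ℝ (Fin 3))
        (g : EuclideanSpace ℝ (Fin 3) → EuclideanSpace ℝ (Fin 3)),
        ThinObject M q v g → ¬ IsDiscretelySelfSimilar c v := by
  obtain ⟨c₁, hc₁, h⟩ := AxisActivity.thinObject_not_nearOneDss M
  refine ⟨c₁, hc₁, fun c hc hcc q v g hv hdss => h c hc hcc q v g 0 hv ?_⟩
  simpa only [add_zero] using hdss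

/-- **No thin object is backward self-similar.**  A (continuously) self-similar field
(`IsSelfSimilar v`: `λ v(λ²t, λx) = v(t,x)` for all `λ > 0`) is `c`-DSS for every `c > 0`, in
particular for `c` in the excluded near-one window `(1, c₁(M))`. [folklore] -/
theorem thinObject_not_selfSimilar {M q : ℝ}
    {v : ℝ → EuclideanSpace ℝ (Fin 3) → EuclideanSpace ℝ (Fin 3)}
    {g : EuclideanSpace ℝ (Fin 3) → EuclideanSpace ℝ (Fin 3)} (hv : ThinObject M q v g) :
    ¬ IsSelfSimilar v := by
  intro hss
  obtain ⟨c₁, hc₁, h⟩ := thinObject_not_dss_nearOne M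
  exact h ((1 + c₁) / 2) (by linarith) (by linarith) q v g hv (hss _ (by linarith))

end Summit.NavierStokesRegularity.NavierStokesRegularity.Theorems.ThinCascade

end
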